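import Summits.QuantumFields.YangMills.Theorems.BalabanUVNodesN14DecoupledDressing
import Summits.QuantumFields.YangMills.Theorems.BalabanUVNodesN18KingModel

/-!
# BalabanUVNodes ∕ node N14 = NE1′ — `DressedStabilityStrict` AT THE KING-MODEL SCALES: the dressed tower of the L-ADIC BLOCK
# HIERARCHY of a `dS`-dimensional source tube (positional rate `Λ = L^{dS}`), ROOT-C OF RECORD as the numeric letter `L^{dS}·θ < 1`
# (King's `θ = L^{−γ}`: `dS < γ`), and its NECESSITY on a saturating run — a MODEL RUNG ∕ BC5-type witness, count-neutral

Cell `pub-ymgap`, HUMAN RULING D-0149 (T⁴ apex work-bound push, director-ym №197), width seat `pub-ymgap-dag-n14-w3` g0; plan g77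
`W-SEAT-START-LIST.md` v3 §2 «n14 NE1′» ITEM 3 («`DressedStabilityStrict` at the KING MODEL scales (`…N18KingModelScales` currency) as the
rung (BC5-type witness) — S∕M»); key K3⁷ = stmt-QuantumFields-20544 `SpineGivenEndpointR13SepCoPH` (`--supports … --as helper`); venue R424
(`YangMills/Theorems`, namespace `YMDAG.N14.KingScales`).  ADDITIVE — imports dag-n14-c g2's `Thm/BalabanUVNodesN14DecoupledDressing` (p459546:
`DecoupledRun`, `Window`, `birthSize`, `amp`, `birthSize_le` — the born dressed action terms under the PRINTED provisos of
[Balaban1989LargeFieldII] (1.73)–(1.75), through dag-n14-b's `B16Ineq175Tilted` and n14-c's `B16DressedActionTerm`) and n18-a's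
`Thm/BalabanUVNodesN18KingModel` (`kingTheta_pos`, `kingTheta_lt_one`: King's rate letter `θ = L^{−γ}`) ONLY; modifies nothing; every cited
lemma is used BY NAME.

WHY (the slot this feeds).  In the K3⁷ rates bundle `RatesHolderAt D R β` (dag-n16-e `Thm/BalabanUVNodesSpineRatesHolder`, plan g77 K3 v2 DRAFT)
node N14's slot is `N14At R.ne1 := DressedStabilityStrict R.ne1.𝒯 R.ne1.Λ` (ROOT-C OF RECORD, `Spine/NE1p/DressedRootStrict` :58).  Two model
inhabitants of that SHAPE are in the tree: the EMPTY tower (dag-n14-a `s_N14_of_empty`; dag-n18-e evidence #5 `keyedRates_junk`) and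
dag-n14-c's SCALE-DECOUPLED tower (`YMDAG.N14.Decoupled.dressedStabilityStrict_tower`) whose positional rate is the HIERARCHICAL `Λ = 1` (one
birth position per scale under every cube), so that the strict product `Λ·ρ₁·τ < 1` degenerates to `θ < 1`.  The present file puts the
SAME born terms on KING'S SCALES — the L-adic block hierarchy of King's block-spin transformation ([King1986] (2.10): blocks of `L^d` sites
per step), restricted to a source tube of dimension `dS` (a loop: `dS = 1`; a box-filling source: `dS = d`) — where the positional count
GROWS, `#{births of scale j under a k-cube} = (L^{dS})^{k−j}`, and ROOT-C's strict product becomes a GENUINE numeric letter.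

THE MODEL (§1–§2).  Cutoff `K`; a birth ∕ cube of scale `j ≤ K` is a position `y : Fin dS → Fin (L^{K−j})` in the tube's block hierarchy
(`Pos L dS K`); `b` is FELT at `q` iff `q`'s block contains `b`'s (`Under`: coordinatewise `y_μ ∕ L^{k−j} = x_μ`).  The fibre data are n14-c's
`R : DecoupledRun Z` (per depth `n = K − j` ONE complex-weight step under the printed provisos, fibre piece `W_n` with `‖W_n − c_n‖ ≤ C·θⁿ`,
source window `‖t‖ ≤ l₀` on the tilt disc), the SAME at every position (translation invariance); the booked size of the birth `(j, y)` at
every later scale is `birthSize R (K − j) t` — transport scale-DECOUPLED (`ρ₁ = 1`).  §1 `card_filter_under_le` (residues mod `L^{k−j}`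
inject), `positionalCount_tower` (`N₀ = 1`, **`Λ = L^{dS}`**), `le_card_feltOfScale_top` (under the TOP cube ALL `(L^{dS})^{K−j}` births of
scale `j` are felt: `≥ 1` member per scale, growing — the tower is neither empty nor hierarchical).

WHAT IS PROVED (kernel, 0 sorry).  §3 `classAt_tower` ∕ `dressedStabilityWith_tower` (class `twoRate amp 1 θ K` from `birthSize_le` BY NAME);
**`dressedStabilityStrict_tower : (L^{dS})·θ < 1 → DressedStabilityStrict (tower L dS R) (L^{dS})`** (ROOT-C OF RECORD with
`(A₀, ρ₁, τ, r) = (amp, 1, θ, L^{dS}θ)`, owner's `dressedStabilityStrict_of_with` BY NAME); `n14At_tower` (the route's `YMDAG.UVSplit.N14At` at the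
model carriers); `dressedBudget_tower` (ROOT-B by the owner's `dressedBudget_of_dressedStabilityStrict`).  §4 KING'S LETTER: `kingLetter_iff`
(`L^{dS}·L^{−γ} < 1 ⟺ dS < γ`, `L ≥ 2`) and `dressedStabilityStrict_tower_kingTheta` (`R.θ = L^{−γ}`, `dS < γ` ⟹ ROOT-C at `Λ = L^{dS}`).
§5 NECESSITY [decided toy]: `flatRun θ` — Dirac fibres, `ρ₀ ≡ 1`, `σ ≡ 0`, CONSTANT fibre piece `W_n ≡ θⁿ∕2` left un-subtracted (`c ≡ 0`),
`s = 0`, `B = C = ½`, `l₀ = 1`: every proviso of `DecoupledRun` in kernel, and the born term at source `t = 1` IS `θⁿ∕2`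
(`birthSize_flatRun_one` — the first-order birth bound is SATURATED); **`not_dressedStabilityStrict_flat`**: if `1 ≤ L^{dS}·θ` the top
cube's unit-weight load at cutoff `K` is `≥ (K+1)∕2`, so ROOT-B fails and hence ROOT-C fails AT THE TOWER'S OWN POSITIONAL RATE;
**`dressedStabilityStrict_flat_iff`**: on the flat runs ROOT-C at `Λ = L^{dS}` holds IFF `L^{dS}·θ < 1`.  THE LETTERS HAVE CONTENT: at
King's printed Hölder rates `0 < γ ≤ 1` (Prop. 3.8 ∕ Lemma 4.4) the condition `dS < γ` holds for NO source of dimension `dS ≥ 1` — with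
first-order births and no flatness gain, a loop's dressed tower at King's scales does NOT meet ROOT-C; the cell's reading books instead
`τ = θ₁ = L⁻³` with a flatness gain `φ` against `Λ = L⁴` (`T4TermFormat.Booking.cubeBudget_of_twoRate`, G-pv16g4-7 (β2): «whether the printed
rates meet these products is NOT asserted») — this file makes that dimension-versus-decay inequality the displayed letter of the N14 slot.

HONEST FRAMING (A6 ∕ №189).  A MODEL RUNG over hypothesis SHAPES and a decided toy — NOT a discharge claim: births are genuine complex-weight
integrals under the printed (1.73)–(1.75) provisos (inhabited non-degenerately by n14-c's `twoPoint` and, saturating, by `flatRun`),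
positions are King's L-adic blocks, transport is scale-DECOUPLED (`ρ₁ = 1` — the inter-scale content of NE1′, the transport leaf T ∕ (w4) ∕
(I4′) and regeneration (w5), is discharged VACUOUSLY, said not hidden); nothing of Bałaban's densities and none of King's operators is
instantiated; King's `A = 0` model has no running coupling.  NE1′ is NOT PRINTED ([Balaban1989LargeFieldII] p. 356 ll. 1–6 defers
observables) and NOT PROVED; N14 NOT discharged (DEPENDENT on §N19 s1 ∕ U3, director-ym №195 (8)); count-neutral (typed 28∕28, discharged
5∕27 — UNMOVED).  One finite four-torus programme at fixed ε; R4 closes only the conditional finite-𝕋⁴ rung `BalabanLadder.UV` — NOT ℝ⁴, NOT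
OS, NOT a mass gap, NOT Clay.  [folklore] kernel mathematics over the cited modules; 0 sorry; standard axioms.

Sources: C. King, Commun. Math. Phys. **102** (1986) 649–677 [King1986] — (2.10) p. 653 (v1.0.1: ref-N READ-2 NIT, was «p. 652»), Prop. 3.8 (3.71) p. 664, Lemma 4.4 (4.29) p. 673;
T. Bałaban, Commun. Math. Phys. **122** (1989) 355–392 [Balaban1989LargeFieldII] (1.73)–(1.75) pp. 379–380.  No claim about the mass gap.
-/

noncomputable section

namespace YMDAG.N14.KingScales

open MeasureTheory Finset
open scoped BigOperators
open Literature.MathematicalPhysics.QuantumFieldTheory.Balaban1983to89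
open Literature.MathematicalPhysics.QuantumFieldTheory.Balaban1983to89.T4TermFormat
open Literature.MathematicalPhysics.QuantumFieldTheory.Balaban1983to89.T4TermFormat.Booking
open Literature.MathematicalPhysics.QuantumFieldTheory.Balaban1983to89.T4TrajectoryComparison
open Literature.MathematicalPhysics.QuantumFieldTheory.Balaban1983to89.B16Ineq175Tilted (tiltWeight_apply)
open Literature.MathematicalPhysics.QuantumFieldTheory.Balaban1983to89.B16DressedActionTerm
open Summit.QuantumFields.BalabanUV.T4Continuum.NE1p.DressedRoot
open Summit.QuantumFields.YangMills.BalabanUVNodes.N18KingModel (kingTheta_pos kingTheta_lt_one)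
open YMDAG.UVSplit (NE1pCarriers N14At)
open YMDAG.N14.Decoupled

variable {Z : Type} [MeasurableSpace Z]

/-! ## §1 King's scales: the L-adic block hierarchy of a `dS`-dimensional source tube, and its positional counts -/

/-- **BIRTHS ∕ CUBES AT CUTOFF `K`** [model geometry]: a scale `j ≤ K` and a position `y : Fin dS → Fin (L^{K−j})` — the `(L^{dS})^{K−j}`
blocks of side `L^{−(K−j)}` of the `dS`-dimensional unit source tube ([King1986] (2.10): `L^d` sites per block per step; here `dS ≤ d`
coordinates along the source). -/
abbrev Pos (L dS K : ℕ) : Type := Σ j : Fin (K + 1), (Fin dS → Fin (L ^ (K - j.val)))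

/-- **`b` LIES UNDER `q`** [model geometry]: `scale b ≤ scale q` and the block of `q` contains the block of `b` — coordinatewise
`y_μ ∕ L^{scale q − scale b} = x_μ` (integer division). -/
def Under (L : ℕ) {dS K : ℕ} (b q : Pos L dS K) : Prop :=
  b.1.val ≤ q.1.val ∧ ∀ μ, (b.2 μ).val / L ^ (q.1.val - b.1.val) = (q.2 μ).val

/-- **AT MOST `(L^{dS})^{k−j}` SCALE-`j` POSITIONS UNDER ONE SCALE-`k` BLOCK** [counting]: on the births of scale `j` under `q` the
coordinatewise residues mod `L^{k−j}` are injective into `(Fin dS → range L^{k−j})`. -/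
theorem card_filter_under_le {L dS K : ℕ} (hL : 1 ≤ L) (s : Finset (Pos L dS K)) (q : Pos L dS K) (j : ℕ)
    (hs : ∀ b ∈ s, Under L b q ∧ b.1.val = j) :
    (s.card : ℝ) ≤ ((L : ℝ) ^ dS) ^ (q.1.val - j) := by
  set n := q.1.val - j with hn
  have hLn : 0 < L ^ n := pow_pos (by omega) n
  let f : Pos L dS K → (Fin dS → ℕ) := fun b μ => (b.2 μ).val % L ^ n
  have hmaps : ∀ b ∈ s, f b ∈ Fintype.piFinset fun _ : Fin dS => range (L ^ n) := by
    intro b _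
    exact Fintype.mem_piFinset.mpr fun μ => mem_range.mpr (Nat.mod_lt _ hLn)
  have hinj : Set.InjOn f s := by
    rintro ⟨j₁, y₁⟩ h₁ ⟨j₂, y₂⟩ h₂ hf
    obtain ⟨⟨_, hu₁⟩, hj₁⟩ := hs _ h₁
    obtain ⟨⟨_, hu₂⟩, hj₂⟩ := hs _ h₂
    have hjj : j₁ = j₂ := Fin.ext (hj₁.trans hj₂.symm)
    subst hjj
    have hy : y₁ = y₂ := by
      funext μ
      apply Fin.ext
      have r : (y₁ μ).val % L ^ n = (y₂ μ).val % L ^ n := congr_fun hf μ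
      have d₁ : (y₁ μ).val / L ^ n = (q.2 μ).val := by rw [hn, ← hj₁]; exact hu₁ μ
      have d₂ : (y₂ μ).val / L ^ n = (q.2 μ).val := by rw [hn, ← hj₁]; exact hu₂ μ
      rw [← Nat.div_add_mod (y₁ μ).val (L ^ n), ← Nat.div_add_mod (y₂ μ).val (L ^ n), r, d₁, d₂]
    subst hy
    rfl
  have hcard := Finset.card_le_card_of_injOn f hmaps hinj
  rw [Fintype.card_piFinset, prod_const, card_univ, Fintype.card_fin, card_range] at hcard
  calc (s.card : ℝ) ≤ (((L ^ n) ^ dS : ℕ) : ℝ) := by exact_mod_cast hcard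
    _ = ((L : ℝ) ^ dS) ^ n := by push_cast; rw [← pow_mul, ← pow_mul, mul_comm]

/-! ## §2 The King-scales dressed tower: the decoupled births booked on the block hierarchy -/

open Classical in
/-- **THE BOOKING AT SOURCE `t` AND CUTOFF `K`** [model]: births = cubes = localisation domains = the tube's block hierarchy `Pos L dS K`;
`b` felt at `q` iff `Under L b q`; the booked size of the birth `(j, y)` at every scale is dag-n14-c's `birthSize R (K − j) t` (the born dressed
action term of depth `K − j` past its field-independent linear part; nothing transported); no Bałaban terms, no pair strengths. -/
def booking (L dS : ℕ) (R : DecoupledRun Z) (t : ℂ) (K : ℕ) : T4TermFormat.Booking where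
  K := K
  Dom := Pos L dS K
  domScale := fun X => X.1.val
  treeLen := fun _ => 0
  treeLen_nonneg := fun _ => le_rfl
  balSize := fun _ => 0
  Birth := Pos L dS K
  births := Finset.univ
  mem_births := fun b => Finset.mem_univ b
  birthScale := fun b => b.1.val
  birth_le := fun b => Nat.lt_succ_iff.mp b.1.isLt
  loc := fun b => b
  loc_scale := fun _ => rfl
  Cube := Pos L dS K
  cubes := Finset.univ
  mem_cubes := fun q => Finset.mem_univ q
  cubeScale := fun q => q.1.val
  cube_le := fun q => Nat.lt_succ_iff.mp q.1.isLt
  feltAt := fun q => Finset.univ.filter fun b => Under L b q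
  felt_birth_le := fun _ _ hb => (Finset.mem_filter.mp hb).2.1
  size := fun b _ => birthSize R (K - b.1.val) t
  size_nonneg := fun b _ => birthSize_nonneg R (K - b.1.val) t
  pair := fun _ _ _ => 0

/-- **ITS TRAJECTORY** [model]: one generation per family (the birth), re-linearised size = the booked size at every later scale. -/
def trajectory (L dS : ℕ) (R : DecoupledRun Z) (t : ℂ) (K : ℕ) : Trajectory (booking L dS R t K) where
  lin := fun b k' _ => if k' = b.1.val then birthSize R (K - b.1.val) t else 0
  lin_nonneg := fun b k' _ => by split_ifs <;> first | exact birthSize_nonneg R (K - b.1.val) t | exact le_rfl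
  gen := fun b k' => if k' = b.1.val then birthSize R (K - b.1.val) t else 0
  gen_nonneg := fun b k' => by split_ifs <;> first | exact birthSize_nonneg R (K - b.1.val) t | exact le_rfl
  size_le := fun b k hjk _ => by
    show birthSize R (K - b.1.val) t ≤ ∑ k' ∈ Icc b.1.val k, (if k' = b.1.val then birthSize R (K - b.1.val) t else 0)
    have hjk' : b.1.val ∈ Icc b.1.val k := Finset.mem_Icc.mpr ⟨le_rfl, hjk⟩
    rw [Finset.sum_ite_eq' (Icc b.1.val k) b.1.val (fun _ => birthSize R (K - b.1.val) t), if_pos hjk']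

/-- **THE KING-SCALES DRESSED TOWER** [model]: run parameter = the source `t` in the K-free window `‖t‖ ≤ l₀`; at every cutoff the booking
and trajectory above. -/
def tower (L dS : ℕ) (R : DecoupledRun Z) : DressedTower (Window R.l₀) where
  B := fun p K => booking L dS R p.val K
  K_eq := fun _ _ => rfl
  T := fun p K => trajectory L dS R p.val K

/-- The tower's carriers in the route's vocabulary at the BLOCK positional rate `Λ = L^{dS}`. [model] -/
def carriers (L dS : ℕ) (R : DecoupledRun Z) : NE1pCarriers := ⟨Window R.l₀, tower L dS R, (L : ℝ) ^ dS⟩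

/-- **POSITIONAL COUNT AT KING'S SCALES** [counting]: `#{births of scale j felt at a cube of scale k} ≤ 1·(L^{dS})^{k−j}` — the K-free count
of `DressedRoot.cubeBudget_of_dressedStabilityWith` with `N₀ = 1`, `Λ = L^{dS}` (§1 BY NAME). -/
theorem positionalCount_tower {L : ℕ} (hL : 1 ≤ L) (dS : ℕ) (R : DecoupledRun Z) (p : Window R.l₀) (K : ℕ) :
    ((tower L dS R).B p K).PositionalCount fun j k => 1 * ((L : ℝ) ^ dS) ^ (k - j) := by
  classical
  intro q j
  show ((_ : ℕ) : ℝ) ≤ 1 * ((L : ℝ) ^ dS) ^ (q.1.val - j)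
  rw [one_mul]
  refine card_filter_under_le hL _ q j fun b hb => ?_
  obtain ⟨hb1, hb2⟩ := mem_feltOfScale.mp hb
  exact ⟨(Finset.mem_filter.mp hb1).2, hb2⟩

/-- **NON-DEGENERACY OF THE GEOMETRY** [counting]: under the TOP cube every birth is felt, so the births of scale `j ≤ K` felt there number
AT LEAST `(L^{dS})^{K−j}`: `≥ 1` member per scale, growing geometrically in the depth — neither the empty tower nor the hierarchical one. -/
theorem le_card_feltOfScale_top {L : ℕ} (hL : 1 ≤ L) (dS : ℕ) (R : DecoupledRun Z) (p : Window R.l₀) (K : ℕ) {j : ℕ} (hj : j ≤ K) :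
    ((L : ℝ) ^ dS) ^ (K - j) ≤
      ((((tower L dS R).B p K).feltOfScale ⟨Fin.last K, fun _ => ⟨0, pow_pos (by omega) _⟩⟩ j).card : ℝ) := by
  classical
  let top : Pos L dS K := ⟨Fin.last K, fun _ => ⟨0, pow_pos (by omega) _⟩⟩
  let g : (Fin dS → Fin (L ^ (K - j))) → Pos L dS K := fun y => ⟨⟨j, Nat.lt_succ_of_le hj⟩, y⟩
  have hmaps : ∀ y ∈ (Finset.univ : Finset (Fin dS → Fin (L ^ (K - j)))),
      g y ∈ ((tower L dS R).B p K).feltOfScale top j := by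
    intro y _
    have hfelt : g y ∈ ((tower L dS R).B p K).feltAt top := by
      show g y ∈ (Finset.univ : Finset (Pos L dS K)).filter (fun b => Under L b top)
      exact Finset.mem_filter.mpr ⟨Finset.mem_univ _, hj, fun μ => Nat.div_eq_of_lt (y μ).isLt⟩
    exact mem_feltOfScale.mpr ⟨hfelt, rfl⟩
  have hinj : Set.InjOn g (Finset.univ : Finset (Fin dS → Fin (L ^ (K - j)))) := by
    intro y₁ _ y₂ _ h
    simpa [g] using h
  have hcard := Finset.card_le_card_of_injOn g hmaps hinj
  rw [card_univ, Fintype.card_pi, prod_const, card_univ, Fintype.card_fin, Fintype.card_fin] at hcard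
  calc ((L : ℝ) ^ dS) ^ (K - j) = (((L ^ (K - j)) ^ dS : ℕ) : ℝ) := by push_cast; rw [← pow_mul, ← pow_mul, mul_comm]
    _ ≤ _ := by exact_mod_cast hcard

/-! ## §3 The decl of record at King's scales: the class, the root with constants, the strict root, the node statement, ROOT-B -/

/-- **THE CLASS AT EVERY CUTOFF AND SOURCE** [booked dressing estimate]: every booking lies in `twoRate amp 1 θ K` (`birthSize_le` BY NAME). -/
theorem classAt_tower (L dS : ℕ) (R : DecoupledRun Z) (p : Window R.l₀) (K : ℕ) :
    ClassAt ((tower L dS R).B p K) (amp R) 1 R.θ := by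
  intro b k _ _
  show birthSize R (K - b.1.val) p.val ≤ twoRate (amp R) 1 R.θ K b.1.val k
  rw [twoRate, one_pow, mul_one]
  exact birthSize_le R (K - b.1.val) p.property

/-- **THE ROOT WITH ITS CONSTANTS DISPLAYED** [bookkeeping + `birthSize_le`]: ONE `(amp, 1, θ)` before every source in the window and every cutoff. -/
theorem dressedStabilityWith_tower (L dS : ℕ) (R : DecoupledRun Z) : DressedStabilityWith (tower L dS R) (amp R) 1 R.θ :=
  ⟨amp_nonneg R, zero_le_one, R.hθ0, R.hθ1.le, fun p K => classAt_tower L dS R p K⟩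

/-- **THE DECL OF RECORD AT KING'S SCALES** [the row's sentence as a theorem]: at the block positional rate `Λ = L^{dS}`, IF the numeric letter
`L^{dS}·θ < 1` holds THEN `DressedStabilityStrict (tower L dS R) (L^{dS})` — ROOT-C OF RECORD with `(A₀, ρ₁, τ, r) = (amp, 1, θ, L^{dS}·θ)`
(`DressedRootStrict.dressedStabilityStrict_of_with` BY NAME).  NOT a discharge of N14: the tower of record is Bałaban's (NODE O), not this one. -/
theorem dressedStabilityStrict_tower (L dS : ℕ) (R : DecoupledRun Z) (hprod : (L : ℝ) ^ dS * R.θ < 1) :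
    DressedStabilityStrict (tower L dS R) ((L : ℝ) ^ dS) :=
  dressedStabilityStrict_of_with (r := (L : ℝ) ^ dS * R.θ) (dressedStabilityWith_tower L dS R) (by positivity) (by rw [mul_one]) hprod

/-- **THE ROUTE's NODE STATEMENT AT THE MODEL CARRIERS** [by name]: `YMDAG.UVSplit.N14At ⟨window, tower, L^{dS}⟩` under the letter `L^{dS}·θ < 1`. -/
theorem n14At_tower (L dS : ℕ) (R : DecoupledRun Z) (hprod : (L : ℝ) ^ dS * R.θ < 1) : N14At (carriers L dS R) :=
  dressedStabilityStrict_tower L dS R hprod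

/-- **ROOT-B AT KING'S SCALES** [owner's `dressedBudget_of_dressedStabilityStrict` BY NAME + §1]: under the letter, weights in `[0, w̄]` carry ROOT-B. -/
theorem dressedBudget_tower {L : ℕ} (hL : 1 ≤ L) (dS : ℕ) (R : DecoupledRun Z) (hprod : (L : ℝ) ^ dS * R.θ < 1) {wbar : ℝ}
    (hwbar : 0 ≤ wbar) (w : Window R.l₀ → ℕ → ℕ → ℝ) (hw0 : ∀ p K, ∀ j ≤ K, 0 ≤ w p K j) (hwb : ∀ p K, ∀ j ≤ K, w p K j ≤ wbar) :
    DressedBudget (tower L dS R) w :=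
  dressedBudget_of_dressedStabilityStrict (N₀ := 1) (dressedStabilityStrict_tower L dS R hprod) zero_le_one hwbar hw0 hwb
    fun p K => positionalCount_tower hL dS R p K

/-! ## §4 King's letter: `θ = L^{−γ}` — the strict product is the inequality `dS < γ` -/

/-- **THE LETTER** [arith]: for `L ≥ 2`, `L^{dS}·L^{−γ} < 1 ⟺ dS < γ`. -/
theorem kingLetter_iff {L : ℕ} (hL : 2 ≤ L) (dS : ℕ) (γ : ℝ) : (L : ℝ) ^ dS * (L : ℝ) ^ (-γ) < 1 ↔ (dS : ℝ) < γ := by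
  have hL1 : (1 : ℝ) < L := by exact_mod_cast hL
  have hL0 : (0 : ℝ) < L := by linarith
  have key : (L : ℝ) ^ dS * (L : ℝ) ^ (-γ) = (L : ℝ) ^ ((dS : ℝ) - γ) := by
    rw [← Real.rpow_natCast, ← Real.rpow_add hL0, sub_eq_add_neg]
  rw [key]
  constructor
  · intro h
    by_contra hle
    have hle' : γ ≤ (dS : ℝ) := not_lt.mp hle
    have : (1 : ℝ) ≤ (L : ℝ) ^ ((dS : ℝ) - γ) := Real.one_le_rpow hL1.le (by linarith)
    linarith
  · intro h
    exact Real.rpow_lt_one_of_one_lt_of_neg hL1 (by linarith)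

/-- **ROOT-C AT KING'S SCALES IN KING'S LETTER**: if the source decay is King's rate `θ = L^{−γ}` ([King1986] Prop. 3.8 ∕ Lemma 4.4 shape) and
`dS < γ`, then `DressedStabilityStrict (tower L dS R) (L^{dS})`.  THE CONTENT: King's printed `0 < γ ≤ 1` meets `dS < γ` for NO `dS ≥ 1`. -/
theorem dressedStabilityStrict_tower_kingTheta {L : ℕ} (hL : 2 ≤ L) (dS : ℕ) (R : DecoupledRun Z) {γ : ℝ} (hθ : R.θ = (L : ℝ) ^ (-γ))
    (hγ : (dS : ℝ) < γ) : DressedStabilityStrict (tower L dS R) ((L : ℝ) ^ dS) :=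
  dressedStabilityStrict_tower L dS R (by rw [hθ]; exact (kingLetter_iff hL dS γ).mpr hγ)

/-! ## §5 Necessity: the flat saturating run — at `L^{dS}·θ ≥ 1` ROOT-B and ROOT-C fail at the tower's own positional rate -/

section Flat
/-- **THE FLAT SATURATING RUN** [decided toy]: Dirac fibres on `Unit`, `ρ₀ ≡ 1`, `σ ≡ 0`, CONSTANT fibre piece `W_n ≡ θⁿ∕2` left un-subtracted
(`c ≡ 0`), `s = 0`, `B = C = ½`, `l₀ = 1` — every proviso of `DecoupledRun` checked in kernel (tilt disc `0 + 1·½ ≤ 1`); the born term of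
depth `n` at source `t` is `t·θⁿ∕2`, saturating the first-order birth bound. -/
def flatRun (θ : ℝ) (hθ0 : 0 ≤ θ) (hθ1 : θ < 1) : DecoupledRun Unit where
  μ := fun _ => Measure.dirac ()
  ρ₀ := fun _ _ => 1
  σ := fun _ _ => 0
  W := fun n _ => ((θ ^ n / 2 : ℝ) : ℂ)
  c := fun _ => 0
  s := 0
  B := 1 / 2
  C := 1 / 2
  θ := θ
  l₀ := 1
  hρ := fun _ => integrable_const _
  hρ0 := fun _ => ae_of_all _ fun _ => zero_le_one
  hP := fun _ => by rw [integral_dirac]; exact zero_lt_one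
  hσm := fun _ => aestronglyMeasurable_const
  hWm := fun _ => aestronglyMeasurable_const
  hσ := fun _ => ae_of_all _ fun _ => by simp
  hW := fun n => ae_of_all _ fun _ => by
    have h1 : θ ^ n ≤ 1 := pow_le_one₀ hθ0 hθ1.le
    rw [Complex.norm_real, Real.norm_eq_abs, abs_of_nonneg (by positivity)]
    linarith
  hosc := fun n => ae_of_all _ fun _ => by
    rw [sub_zero, Complex.norm_real, Real.norm_eq_abs, abs_of_nonneg (by positivity)]
    linarith
  hC := by norm_num
  hθ0 := hθ0
  hθ1 := hθ1
  hl₀ := zero_le_one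
  hdiscB := by norm_num
  hdiscC := by norm_num

variable {θ : ℝ} (hθ0 : 0 ≤ θ) (hθ1 : θ < 1)

/-- The tilted normalisation of the flat run at a REAL source `x`: `e^{x·θⁿ∕2}`. [folklore] -/
theorem tiltNorm_flatRun (n : ℕ) (x : ℝ) :
    tiltNorm (Measure.dirac ()) (fun _ => (1 : ℝ)) (fun _ => (0 : ℂ)) (fun _ => ((θ ^ n / 2 : ℝ) : ℂ)) (x : ℂ) =
      ((Real.exp (x * (θ ^ n / 2)) : ℝ) : ℂ) := by
  rw [tiltNorm_def, integral_dirac, tiltWeight_apply, zero_add, Complex.ofReal_one, one_mul, ← Complex.ofReal_mul,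
    Complex.ofReal_exp]

/-- **THE BORN TERM OF THE FLAT RUN AT SOURCE `t = 1` IS `θⁿ∕2`** [decided toy]: `log e^{θⁿ∕2} − log e^0` — the birth bound is saturated. -/
theorem birthSize_flatRun_one (n : ℕ) : birthSize (flatRun θ hθ0 hθ1) n 1 = θ ^ n / 2 := by
  unfold birthSize
  show ‖dressLog (Measure.dirac ()) (fun _ => (1 : ℝ)) (fun _ => (0 : ℂ)) (fun _ => ((θ ^ n / 2 : ℝ) : ℂ)) 1 - 1 * (0 : ℂ)‖ = θ ^ n / 2
  rw [mul_zero, sub_zero, dressLog]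
  have h1 := tiltNorm_flatRun (θ := θ) n 1
  have h0 := tiltNorm_flatRun (θ := θ) n 0
  rw [Complex.ofReal_one] at h1; rw [Complex.ofReal_zero] at h0
  rw [h1, h0, one_mul, zero_mul, Real.exp_zero, Complex.ofReal_one, Complex.log_one, sub_zero,
    ← Complex.ofReal_log (Real.exp_pos _).le, Real.log_exp, Complex.norm_real, Real.norm_eq_abs, abs_of_nonneg (by positivity)]

/-- The unit source lies in the flat run's window `‖t‖ ≤ l₀ = 1`. [folklore] -/
def oneSource : Window (flatRun θ hθ0 hθ1).l₀ := ⟨1, by show ‖(1 : ℂ)‖ ≤ 1; rw [norm_one]⟩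

/-- **THE TOP CUBE's LOAD** [decided toy]: at source `t = 1`, cutoff `K`, the births of scale `j ≤ K` load the top cube by `≥ (L^{dS}·θ)^{K−j}∕2`. -/
theorem le_load_top {L : ℕ} (hL : 1 ≤ L) (dS K : ℕ) {j : ℕ} (hj : j ≤ K) :
    ((L : ℝ) ^ dS * θ) ^ (K - j) / 2 ≤
      ((tower L dS (flatRun θ hθ0 hθ1)).B (oneSource hθ0 hθ1) K).load ⟨Fin.last K, fun _ => ⟨0, pow_pos (by omega) _⟩⟩ j := by
  set Bk := (tower L dS (flatRun θ hθ0 hθ1)).B (oneSource hθ0 hθ1) K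
  set top : Bk.Cube := ⟨Fin.last K, fun _ => ⟨0, pow_pos (by omega) _⟩⟩
  have hsum : Bk.load top j = ∑ b ∈ Bk.feltOfScale top j, θ ^ (K - j) / 2 := by
    unfold Booking.load
    refine Finset.sum_congr rfl fun b hb => ?_
    have hb2 : b.1.val = j := (mem_feltOfScale.mp hb).2
    show birthSize (flatRun θ hθ0 hθ1) (K - b.1.val) 1 = θ ^ (K - j) / 2
    rw [hb2, birthSize_flatRun_one]
  rw [hsum, sum_const, nsmul_eq_mul]
  have hcard := le_card_feltOfScale_top hL dS (flatRun θ hθ0 hθ1) (oneSource hθ0 hθ1) K hj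
  have hθn : 0 ≤ θ ^ (K - j) / 2 := by positivity
  calc ((L : ℝ) ^ dS * θ) ^ (K - j) / 2 = ((L : ℝ) ^ dS) ^ (K - j) * (θ ^ (K - j) / 2) := by rw [mul_pow]; ring
    _ ≤ _ := mul_le_mul_of_nonneg_right hcard hθn

/-- **ROOT-B FAILS ON THE CRITICAL FLAT RUN** [decided toy]: if `1 ≤ L^{dS}·θ` the top cube's unit-weight load at cutoff `K` is `≥ (K+1)∕2`. -/
theorem not_dressedBudget_flat {L : ℕ} (hL : 1 ≤ L) (dS : ℕ) (hcrit : 1 ≤ (L : ℝ) ^ dS * θ) :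
    ¬ DressedBudget (tower L dS (flatRun θ hθ0 hθ1)) (fun _ _ _ => (1 : ℝ)) := by
  rintro ⟨cB, hcB⟩
  set K := ⌈2 * cB⌉₊
  have hbud := hcB (oneSource hθ0 hθ1) K ⟨Fin.last K, fun _ => ⟨0, pow_pos (by omega) _⟩⟩
  have hhalf : ∀ j ∈ range (K + 1), (1 : ℝ) / 2 ≤
      1 * ((tower L dS (flatRun θ hθ0 hθ1)).B (oneSource hθ0 hθ1) K).load ⟨Fin.last K, fun _ => ⟨0, pow_pos (by omega) _⟩⟩ j := by
    intro j hj
    have hjK : j ≤ K := Nat.lt_succ_iff.mp (mem_range.mp hj)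
    rw [one_mul]
    refine le_trans ?_ (le_load_top hθ0 hθ1 hL dS K hjK)
    linarith [one_le_pow₀ (M₀ := ℝ) (n := K - j) hcrit]
  have hge : ((K : ℝ) + 1) / 2 ≤ cB := by
    calc ((K : ℝ) + 1) / 2 = ∑ _j ∈ range (K + 1), (1 : ℝ) / 2 := by
          rw [sum_const, card_range, nsmul_eq_mul]; push_cast; ring
      _ ≤ _ := sum_le_sum hhalf
      _ ≤ cB := hbud
  linarith [(Nat.le_ceil (2 * cB) : 2 * cB ≤ (K : ℝ))]

/-- **ROOT-C FAILS ON THE CRITICAL FLAT RUN AT THE TOWER's OWN POSITIONAL RATE** [decided toy]: if `1 ≤ L^{dS}·θ` then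
`¬ DressedStabilityStrict (tower L dS (flatRun θ)) (L^{dS})` — otherwise ROOT-B would follow (`dressedBudget_of_dressedStabilityStrict` with the
§1 count).  The strict-product hypothesis of `dressedStabilityStrict_tower` cannot be dropped. -/
theorem not_dressedStabilityStrict_flat {L : ℕ} (hL : 1 ≤ L) (dS : ℕ) (hcrit : 1 ≤ (L : ℝ) ^ dS * θ) :
    ¬ DressedStabilityStrict (tower L dS (flatRun θ hθ0 hθ1)) ((L : ℝ) ^ dS) := fun h =>
  not_dressedBudget_flat hθ0 hθ1 hL dS hcrit
    (dressedBudget_of_dressedStabilityStrict (N₀ := 1) (wbar := 1) h zero_le_one zero_le_one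
      (fun _ _ _ _ => zero_le_one) (fun _ _ _ _ => le_rfl) fun p K => positionalCount_tower hL dS _ p K)

/-- **THE LETTER IS SHARP ON THE FLAT RUNS** [decided toy + §3]: `DressedStabilityStrict (tower L dS (flatRun θ)) (L^{dS}) ⟺ L^{dS}·θ < 1`. -/
theorem dressedStabilityStrict_flat_iff {L : ℕ} (hL : 1 ≤ L) (dS : ℕ) :
    DressedStabilityStrict (tower L dS (flatRun θ hθ0 hθ1)) ((L : ℝ) ^ dS) ↔ (L : ℝ) ^ dS * θ < 1 :=
  ⟨fun h => lt_of_not_ge fun hc => not_dressedStabilityStrict_flat hθ0 hθ1 hL dS hc h,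
    fun h => dressedStabilityStrict_tower L dS (flatRun θ hθ0 hθ1) h⟩

/-- **AT KING's RATE ON A LOOP THE STRICT ROOT FAILS** [decided toy + King's letter]: `L ≥ 2`, `dS = 1`, `θ = L^{−γ}` with King's printed
`0 < γ ≤ 1` (a `DecoupledRun` letter by n18-a's `kingTheta_pos` ∕ `kingTheta_lt_one`): the flat tower violates ROOT-C at `Λ = L` (`L^{1−γ} ≥ 1`). -/
theorem not_dressedStabilityStrict_flat_kingLoop {L : ℕ} (hL : 2 ≤ L) {γ : ℝ} (hγ0 : 0 < γ) (hγ1 : γ ≤ 1) :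
    ¬ DressedStabilityStrict
      (tower L 1 (flatRun ((L : ℝ) ^ (-γ)) (kingTheta_pos (by omega) γ).le (kingTheta_lt_one hL hγ0))) ((L : ℝ) ^ 1) := by
  refine not_dressedStabilityStrict_flat _ _ (by omega) 1 ?_
  by_contra hlt
  have := (kingLetter_iff hL 1 γ).mp (not_le.mp hlt)
  push_cast at this
  linarith

end Flat
end YMDAG.N14.KingScales

end
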